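import Literature.AlgebraicGeometry.Motives.FanoVariety
import Literature.AlgebraicGeometry.Motives.FunctionFieldOver
import Literature.AlgebraicGeometry.Motives.CartierDivisorClassPullback
import Literature.AlgebraicGeometry.Modules.UnitCocyclePullback
import HarnessLib

/-!
# The dictionary `DivCl(X) ≅ Ȟ¹(X, 𝒪_X^×)` on an integral scheme
# (Görtz–Wedhorn I, Prop. 11.21; Hartshorne II Prop. 6.13–6.15)

Layer `Literature/AlgebraicGeometry/Modules`, namespaces `Literature.AlgebraicGeometry.Motives.CartierDivisor`
(divisor side, dot notation) and `Literature.AlgebraicGeometry.Modules.UnitCocycle` / `….CechPic`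
(cocycle side). THEOREMS ONLY (no definition, no named fact, no instance). Sequels:
`Modules/DetClassOfIso` (rank-one MODULES are classified by their class) and
`AbelianVarieties/HomogeneousLineBundleDivisor` (every rank-one module is `𝒪_X(D)`; homogeneity on an
abelian variety = translation invariance of the divisor class).

The tree holds both currencies for line bundles on an integral scheme `X` and the maps between them,
but not the statement that they agree:

* Cartier divisors `D = (U_i, f_i)` with linear equivalence `D ∼ E` (`Motives/CartierDivisor`,
  Görtz–Wedhorn I, Def. 11.20, (11.9));
* Čech classes of unit cocycles `CechPic X = Ȟ¹(X, 𝒪_X^×)` (`Modules/UnitCocycle`), with the class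
  `D.cechClass = [f_{i(x)}/f_{i(y)}]` of `𝒪_X(D)` (`Motives/FanoVariety`, `CartierDivisor.toUnitCocycle`
  of `HodgeTheory/GAGALineBundlesProofs`) and, conversely, the divisor `(U_x, g_{xξ})` of a cocycle
  (`UnitCocycle.toCartierDivisor`, loc. cit.);

This file proves the dictionary (everything is a theorem; proofs read the cocycles in the function
field `K(X)`, where every unit cocycle is the coboundary of its local equations,
`UnitCocycle.ratFn_div_ratFn`):

* §1 **`DivCl(X) → Ȟ¹(X, 𝒪_X^×)` is a well-defined injective homomorphism** (Görtz–Wedhorn I,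
  Prop. 11.21): `CartierDivisor.cechClass_eq_iff_linEquiv` (`[𝒪(D)] = [𝒪(E)] ↔ D ∼ E`),
  `cechClass_add`, `cechClass_zero`, `cechClass_principal`; the engine is
  `UnitCocycle.equiv_iff_toCartierDivisor_linEquiv` (two cocycles are cohomologous iff their
  divisors are linearly equivalent).
* §2 **… and surjective**: `UnitCocycle.cechClass_toCartierDivisor` (`[𝒪(D_c)] = [c]`),
  `CechPic.exists_cechClass_eq`.
* §3 **Compatibility with pull-back** along a dominant morphism (Görtz–Wedhorn I, (11.16),
  `g^*𝒪(D) ≅ 𝒪(g^*D)`): `CartierDivisor.cechClass_pullback`, `cechClass_classPullback`.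

## References

* U. Görtz, T. Wedhorn, *Algebraic Geometry I: Schemes*, 2nd ed. (2020): (11.9) Def. 11.20,
  Prop. 11.21 and Rem. 11.16 (pp. 369–374); (11.16) Def. 11.49 (p. 392). [GortzWedhorn2020]
* R. Hartshorne, *Algebraic Geometry* (1977), II Prop. 6.13, Prop. 6.15, Cor. 6.16. [Hartshorne1977]
-/

noncomputable section

open CategoryTheory AlgebraicGeometry Opposite TopologicalSpace

universe u

namespace Literature.AlgebraicGeometry.Modules

open Literature.AlgebraicGeometry.Motives Literature.AlgebraicGeometry.Motives.RatFn

namespace UnitCocycle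

variable {Y : Scheme.{u}} [IsIntegral Y] (c c' : UnitCocycle Y)

/-! ### §0 Local equations of a unit cocycle in `K(Y)` -/

omit [IsIntegral Y] c c' in
/-- `Γ(U, 𝒪_Y) → K(Y)` is multiplicative (in the `ofSection` spelling, so that `rw` applies).
[folklore] -/
private theorem ofSection_mul' [IsIntegral Y] {U : Y.Opens} (hU : genericPoint Y ∈ U)
    (σ τ : Γ(Y, U)) : ofSection hU (σ * τ) = ofSection hU σ * ofSection hU τ :=
  map_mul (Y.presheaf.germ U (genericPoint Y) hU).hom σ τ

omit [IsIntegral Y] c c' in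
/-- `Γ(U, 𝒪_Y) → K(Y)` maps `1` to `1` (in the `ofSection` spelling). [folklore] -/
private theorem ofSection_one' [IsIntegral Y] {U : Y.Opens} (hU : genericPoint Y ∈ U) :
    ofSection hU (1 : Γ(Y, U)) = 1 :=
  map_one (Y.presheaf.germ U (genericPoint Y) hU).hom

/-- `f_x / f_y` is a unit at every point of `U_x ∩ U_y` (it is the rational function of the unit
section `g_{xy}`): the condition of Görtz–Wedhorn I, Def. 11.20 for the divisor `(U_x, f_x)` of a
cocycle. [cite: GortzWedhorn2020, Def. 11.20 (p. 373)] -/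
theorem isUnitAt_ratFn_div_ratFn {x y z : Y} (hx : z ∈ c.U x) (hy : z ∈ c.U y) :
    IsUnitAt z (c.ratFn x / c.ratFn y) := by
  rw [c.ratFn_div_ratFn x y]
  exact isUnitAt_ofSection_of_isUnit (c.isUnit_g x y _ inf_le_left inf_le_right) ⟨hx, hy⟩

/-- The rational function of `g_{xy}` over any open `V ∋ ξ` below `U_x ∩ U_y` is `f_x / f_y` (the
cocycle of `𝒪(D)` is `f_i f_j⁻¹`, Görtz–Wedhorn I, Rem. 11.16 / proof of Prop. 11.21).
[cite: GortzWedhorn2020, Prop. 11.21 (p. 374) and Rem. 11.16 (p. 369)] -/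
theorem ofSection_g_eq_ratFn_div (x y : Y) {V : Y.Opens} (hx : V ≤ c.U x) (hy : V ≤ c.U y)
    (hV : genericPoint Y ∈ V) : ofSection hV (c.g x y V hx hy) = c.ratFn x / c.ratFn y := by
  rw [c.ofSection_g x y hx hy hV, c.ratFn_div_ratFn x y]

omit c c' in
/-- The rational function of a restricted section. [folklore] -/
private theorem ofSection_secRes {V V' : Y.Opens} (i : V' ≤ V) (hV' : genericPoint Y ∈ V')
    (s : Γ(Y, V)) : ofSection hV' (secRes Y i s) = ofSection (i hV') s :=
  ofSection_map (homOfLE i) hV' s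

/-- The local equation at the generic point itself is `f_ξ = g_{ξξ} = 1`. [folklore] -/
private theorem ratFn_genericPoint : c.ratFn (genericPoint Y) = 1 := by
  have e : c.ratFn (genericPoint Y) = ofSection (c.genericPoint_mem_genOpen (genericPoint Y))
      (c.g (genericPoint Y) (genericPoint Y) _ inf_le_left inf_le_right) := rfl
  rw [e, c.g_self, ofSection_one']

omit [IsIntegral Y] in
/-- The transition functions of a product of cocycles (definitional). [folklore] -/
private theorem mul_g (x y : Y) (V : Y.Opens) (hx : V ≤ (mul c c').U x) (hy : V ≤ (mul c c').U y) :
    (mul c c').g x y V hx hy = c.g x y V (hx.trans inf_le_left) (hy.trans inf_le_left) *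
      c'.g x y V (hx.trans inf_le_right) (hy.trans inf_le_right) := rfl

/-- The local equations of a product of cocycles are the products of the local equations (the
cocycle of `𝒪(D + E)` is the product of the cocycles, Görtz–Wedhorn I, (11.9): `D ↦ 𝒪_X(D)` is a
homomorphism). [cite: GortzWedhorn2020, Section (11.9) and Prop. 11.21 (p. 374)] -/
theorem ratFn_mul (x : Y) : (mul c c').ratFn x = c.ratFn x * c'.ratFn x := by
  have e : (mul c c').ratFn x = ofSection ((mul c c').genericPoint_mem_genOpen x)
      ((mul c c').g x (genericPoint Y) ((mul c c').U x ⊓ (mul c c').U (genericPoint Y))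
        inf_le_left inf_le_right) := rfl
  rw [e, mul_g, ofSection_mul', c.ofSection_g_eq_ratFn_div, c'.ofSection_g_eq_ratFn_div,
    c.ratFn_genericPoint, c'.ratFn_genericPoint, div_one, div_one]

/-! ### §1 Two cocycles are cohomologous iff their divisors are linearly equivalent -/

/-- **Linearly equivalent divisors give cohomologous cocycles**: if `D_c + div(h)` and `D_{c'}`
are the same divisor then `λ_x := f'_x / (f_x h)` is a unit on `U_x ∩ U'_x` and
`g'_{xy} λ_y = λ_x g_{xy}`. [cite: GortzWedhorn2020, Prop. 11.21 (p. 374)] -/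
theorem equiv_of_toCartierDivisor_linEquiv
    (h : c.toCartierDivisor.LinEquiv c'.toCartierDivisor) : Equiv c c' := by
  obtain ⟨h₀, hh₀, H⟩ := (CartierDivisor.linEquiv_iff _ _).1 h
  -- `H : ∀ x y z, z ∈ U_x → z ∈ U'_y → IsUnitAt z (f_x * h₀ / f'_y)`
  replace H : ∀ (x y z : Y), z ∈ c.U x → z ∈ c'.U y →
      IsUnitAt z (c.ratFn x * h₀ / c'.ratFn y) := H
  have hξ : ∀ x, genericPoint Y ∈ c.U x ⊓ c'.U x :=
    fun x => genericPoint_mem_of_mem ⟨c.mem x, c'.mem x⟩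
  -- the coboundary `λ_x = f'_x / (f_x h₀)` and its inverse are regular over `U_x ∩ U'_x`
  have hreg : ∀ x, ∀ z ∈ c.U x ⊓ c'.U x, IsRegularAt z (c'.ratFn x / (c.ratFn x * h₀)) :=
    fun x z hz => by rw [← inv_div]; exact (H x x z hz.1 hz.2).inv.isRegularAt
  have hreg' : ∀ x, ∀ z ∈ c.U x ⊓ c'.U x, IsRegularAt z (c.ratFn x * h₀ / c'.ratFn x) :=
    fun x z hz => (H x x z hz.1 hz.2).isRegularAt
  have hr := c.ratFn_ne_zero
  have hr' := c'.ratFn_ne_zero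
  exact ⟨{
    W := fun x => c.U x ⊓ c'.U x
    mem := fun x => ⟨c.mem x, c'.mem x⟩
    le := fun x => inf_le_left
    le' := fun x => inf_le_right
    lam := fun x V hV => secRes Y hV (sectionOf (hξ x) _ (hreg x))
    inv := fun x V hV => secRes Y hV (sectionOf (hξ x) _ (hreg' x))
    map_lam := fun x V V' hV i => secRes_secRes hV i _
    lam_mul_inv := fun x V hV => RatFn.section_ext fun hVξ => by
      rw [ofSection_mul', ofSection_one', ofSection_secRes, ofSection_secRes, ofSection_sectionOf,
        ofSection_sectionOf, div_mul_div_comm, mul_comm (c'.ratFn x), div_self]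
      exact mul_ne_zero (mul_ne_zero (hr x) hh₀) (hr' x)
    rel := fun x y V hx hy => RatFn.section_ext fun hVξ => by
      rw [ofSection_mul', ofSection_mul', ofSection_secRes, ofSection_secRes, ofSection_sectionOf,
        ofSection_sectionOf, c.ofSection_g_eq_ratFn_div, c'.ofSection_g_eq_ratFn_div]
      have h1 := hr x; have h2 := hr y; have h3 := hr' x; have h4 := hr' y
      field_simp }⟩

/-- **Cohomologous cocycles have linearly equivalent divisors**: if `g'_{xy} λ_y = λ_x g_{xy}` with
units `λ_x` then `λ_x f_x / f'_x ∈ K(Y)` does not depend on `x`; its inverse `h` satisfies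
`(f_x h / f'_y)_z ∈ 𝒪_{Y,z}^×` on `U_x ∩ U'_y`. [cite: GortzWedhorn2020, Prop. 11.21 (p. 374)] -/
theorem toCartierDivisor_linEquiv_of_equiv (h : Equiv c c') :
    c.toCartierDivisor.LinEquiv c'.toCartierDivisor := by
  obtain ⟨b⟩ := h
  have hξ : ∀ x, genericPoint Y ∈ b.W x := fun x => genericPoint_mem_of_mem (b.mem x)
  -- the units `λ_x` read in `K(Y)`
  set Λ : Y → Y.functionField := fun x => ofSection (hξ x) (b.lam x (b.W x) le_rfl) with hΛ
  have hΛu : ∀ x, ∀ z ∈ b.W x, IsUnitAt z (Λ x) := fun x z hz =>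
    isUnitAt_ofSection_of_isUnit (IsUnit.of_mul_eq_one _ (b.lam_mul_inv x (b.W x) le_rfl)) hz
  have hΛ0 : ∀ x, Λ x ≠ 0 := fun x => (hΛu x x (b.mem x)).ne_zero
  have hr := c.ratFn_ne_zero
  have hr' := c'.ratFn_ne_zero
  -- the coboundary relation in `K(Y)`: `(f'_x / f'_y) Λ_y = Λ_x (f_x / f_y)`
  have hrel : ∀ x y, c'.ratFn x / c'.ratFn y * Λ y = Λ x * (c.ratFn x / c.ratFn y) := by
    intro x y
    have hV : genericPoint Y ∈ b.W x ⊓ b.W y := ⟨hξ x, hξ y⟩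
    have e := congrArg (ofSection hV) (b.rel x y (b.W x ⊓ b.W y) inf_le_left inf_le_right)
    rw [ofSection_mul', ofSection_mul', c'.ofSection_g_eq_ratFn_div, c.ofSection_g_eq_ratFn_div,
      ← b.map_lam y le_rfl (inf_le_right : b.W x ⊓ b.W y ≤ b.W y),
      ← b.map_lam x le_rfl (inf_le_left : b.W x ⊓ b.W y ≤ b.W x),
      ofSection_secRes, ofSection_secRes] at e
    exact e
  -- hence `Λ_x f_x / f'_x` is constant
  have hK : ∀ x z, Λ x * c.ratFn x / c'.ratFn x = Λ z * c.ratFn z / c'.ratFn z := by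
    intro x z
    have e := hrel x z
    have h1 := hr x; have h2 := hr z; have h3 := hr' x; have h4 := hr' z
    field_simp at e
    rw [div_eq_div_iff h3 h4]
    linear_combination -e
  set ξ := genericPoint Y
  set K₀ : Y.functionField := Λ ξ * c.ratFn ξ / c'.ratFn ξ with hK₀
  have hK₀0 : K₀ ≠ 0 := div_ne_zero (mul_ne_zero (hΛ0 ξ) (hr ξ)) (hr' ξ)
  refine (CartierDivisor.linEquiv_iff _ _).2 ⟨K₀⁻¹, inv_ne_zero hK₀0, ?_⟩
  intro x y z hzx hzy
  change IsUnitAt z (c.ratFn x * K₀⁻¹ / c'.ratFn y)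
  have e : c.ratFn x * K₀⁻¹ / c'.ratFn y =
      c.ratFn x / c.ratFn z * (c'.ratFn z / c'.ratFn y) * (Λ z)⁻¹ := by
    rw [hK₀, hK ξ z]
    have h1 := hr x; have h2 := hr z; have h3 := hr' y; have h4 := hr' z; have h5 := hΛ0 z
    field_simp
  rw [e]
  exact ((c.isUnitAt_ratFn_div_ratFn hzx (c.mem z)).mul
    (c'.isUnitAt_ratFn_div_ratFn (c'.mem z) hzy)).mul (hΛu z z (b.mem z)).inv

/-- **Two unit cocycles on an integral scheme are cohomologous iff their Cartier divisors are
linearly equivalent** (`Ȟ¹(Y, 𝒪_Y^×) ↪ DivCl(Y)`). [cite: GortzWedhorn2020, Prop. 11.21 (p. 374)]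
[cite: Hartshorne1977, II Prop. 6.15] -/
theorem equiv_iff_toCartierDivisor_linEquiv :
    Equiv c c' ↔ c.toCartierDivisor.LinEquiv c'.toCartierDivisor :=
  ⟨c.toCartierDivisor_linEquiv_of_equiv c', c.equiv_of_toCartierDivisor_linEquiv c'⟩

/-- The same, for classes: `[c] = [c'] ↔ D_c ∼ D_{c'}`. [cite: GortzWedhorn2020, Prop. 11.21 (p. 374)] -/
theorem mk_eq_mk_iff_toCartierDivisor_linEquiv :
    CechPic.mk c = CechPic.mk c' ↔ c.toCartierDivisor.LinEquiv c'.toCartierDivisor :=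
  (CechPic.mk_eq_mk_iff c c').trans (c.equiv_iff_toCartierDivisor_linEquiv c')

/-- **The divisor of a product of cocycles is the sum of the divisors** (same divisor, on the
common refinement). [cite: GortzWedhorn2020, Section (11.9) (p. 374)] -/
theorem toCartierDivisor_mul_sameDivisor :
    (mul c c').toCartierDivisor.SameDivisor (c.toCartierDivisor + c'.toCartierDivisor) := by
  intro x p z hzx hzp
  change IsUnitAt z ((mul c c').ratFn x / (c.ratFn p.1 * c'.ratFn p.2))
  rw [ratFn_mul, mul_div_mul_comm]
  exact (c.isUnitAt_ratFn_div_ratFn hzx.1 hzp.1).mul (c'.isUnitAt_ratFn_div_ratFn hzx.2 hzp.2)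

end UnitCocycle

end Literature.AlgebraicGeometry.Modules

namespace Literature.AlgebraicGeometry.Motives

namespace CartierDivisor

open RatFn Literature.AlgebraicGeometry.Modules

variable {Y : Scheme.{u}} [IsIntegral Y] (D E : CartierDivisor Y)

/-! ### §1 (continued) `DivCl(Y) → Ȟ¹(Y, 𝒪_Y^×)`, `D ↦ [𝒪_Y(D)]`, is a well-defined injective homomorphism -/

/-- The local equations of the cocycle of `D` are `f_{i(x)} / f_{i(ξ)}` (Görtz–Wedhorn I, Rem. 11.16:
the cocycle of `𝒪(D)` is `f_i / f_j`). [cite: GortzWedhorn2020, Rem. 11.16 (p. 369) and Prop. 11.21 (p. 374)] -/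
theorem ratFn_toUnitCocycle (x : Y) :
    D.toUnitCocycle.ratFn x = D.f (D.chartIdx x) / D.f (D.chartIdx (genericPoint Y)) := by
  change ofSection _ (Y.presheaf.map (homOfLE _).op (D.transFun _ _)) = _
  rw [ofSection_map, ofSection_transFun]

/-- **The divisor of the cocycle of `D` is linearly equivalent to `D`** (it is
`(U_{i(x)}, f_{i(x)} / f_{i(ξ)})`, i.e. `D - div(f_{i(ξ)})` on a refinement). [cite: GortzWedhorn2020, Prop. 11.21 (p. 374)] -/
theorem toCartierDivisor_toUnitCocycle_linEquiv : D.toUnitCocycle.toCartierDivisor.LinEquiv D := by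
  refine (linEquiv_iff _ _).2 ⟨D.f (D.chartIdx (genericPoint Y)), D.f_ne_zero _, ?_⟩
  intro x j z hzx hzj
  change IsUnitAt z (D.toUnitCocycle.ratFn x * _ / _)
  rw [ratFn_toUnitCocycle, div_mul_cancel₀ _ (D.f_ne_zero _)]
  exact D.isUnitAt_div _ j z hzx hzj

/-- **`[𝒪_Y(D)] = [𝒪_Y(E)]` in `Ȟ¹(Y, 𝒪_Y^×)` iff `D ∼ E`** — the map `DivCl(Y) → Pic(Y)` of
Görtz–Wedhorn I, Prop. 11.21 is well defined and injective (Hartshorne II Cor. 6.16 for `Y`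
integral). [cite: GortzWedhorn2020, Prop. 11.21 (p. 374)] [cite: Hartshorne1977, II Prop. 6.13 and Prop. 6.15] -/
theorem cechClass_eq_iff_linEquiv : D.cechClass = E.cechClass ↔ D.LinEquiv E := by
  rw [cechClass_eq_mk, cechClass_eq_mk, UnitCocycle.mk_eq_mk_iff_toCartierDivisor_linEquiv]
  exact ⟨fun h => ((D.toCartierDivisor_toUnitCocycle_linEquiv).symm.trans h).trans
      E.toCartierDivisor_toUnitCocycle_linEquiv,
    fun h => (D.toCartierDivisor_toUnitCocycle_linEquiv.trans h).trans
      E.toCartierDivisor_toUnitCocycle_linEquiv.symm⟩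

variable {D E} in
/-- Linearly equivalent divisors have the same class in `Ȟ¹(Y, 𝒪_Y^×)`. [cite: GortzWedhorn2020, Prop. 11.21 (p. 374)] -/
theorem LinEquiv.cechClass_eq (h : D.LinEquiv E) : D.cechClass = E.cechClass :=
  (cechClass_eq_iff_linEquiv D E).2 h

variable {D E} in
/-- Presentations of the same divisor have the same class in `Ȟ¹(Y, 𝒪_Y^×)` (Görtz–Wedhorn I,
Def. 11.20: they ARE the same Cartier divisor). [cite: GortzWedhorn2020, Def. 11.20 (p. 373) and Prop. 11.21 (p. 374)] -/
theorem SameDivisor.cechClass_eq (h : D.SameDivisor E) : D.cechClass = E.cechClass :=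
  h.linEquiv.cechClass_eq

variable {D E} in
/-- Divisors with the same class in `Ȟ¹(Y, 𝒪_Y^×)` are linearly equivalent (injectivity of
`DivCl(Y) → Pic(Y)`). [cite: GortzWedhorn2020, Prop. 11.21 (p. 374)] -/
theorem linEquiv_of_cechClass_eq (h : D.cechClass = E.cechClass) : D.LinEquiv E :=
  (cechClass_eq_iff_linEquiv D E).1 h

/-- **`[𝒪_Y(div h)] = 1`**: principal divisors have trivial cocycle (`g_{xy} = h / h = 1`).
[cite: GortzWedhorn2020, Prop. 11.21 (p. 374)] -/
theorem cechClass_principal (h : Y.functionField) (hh : h ≠ 0) : (principal h hh).cechClass = 1 := by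
  rw [cechClass_eq_mk, ← CechPic.mk_one]
  refine CechPic.sound (UnitCocycle.equiv_of_eq _ _ (fun _ => ⊤) (fun _ => trivial)
    (fun _ => le_top) (fun _ => le_top) fun x y V hx hy => ?_)
  have e : ∀ i j : (principal h hh).ι, (principal h hh).transFun i j = 1 := fun i j =>
    section_ext fun hU => by
      rw [ofSection_transFun, UnitCocycle.ofSection_one']
      exact div_self hh
  change (1 : Γ(Y, V)) = Y.presheaf.map (homOfLE _).op ((principal h hh).transFun _ _)
  rw [e, map_one]

/-- `[𝒪_Y(0)] = 1` (the neutral element of `Div(Y)` goes to the trivial class).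
[cite: GortzWedhorn2020, Prop. 11.21 (p. 374)] -/
theorem cechClass_zero : (0 : CartierDivisor Y).cechClass = 1 :=
  cechClass_principal 1 one_ne_zero

/-- **`[𝒪_Y(D + E)] = [𝒪_Y(D)] · [𝒪_Y(E)]`**: `DivCl(Y) → Ȟ¹(Y, 𝒪_Y^×)` is a homomorphism
(Görtz–Wedhorn I, Prop. 11.21: "`D ↦ 𝒪_X(D)` is a group homomorphism `Div(X) → Pic(X)`").
[cite: GortzWedhorn2020, Prop. 11.21 (p. 374)] -/
theorem cechClass_add : (D + E).cechClass = D.cechClass * E.cechClass := by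
  rw [cechClass_eq_mk, cechClass_eq_mk, cechClass_eq_mk, ← CechPic.mk_mul]
  refine CechPic.sound ((UnitCocycle.equiv_iff_toCartierDivisor_linEquiv _ _).2 ?_)
  refine ((D + E).toCartierDivisor_toUnitCocycle_linEquiv.trans ?_).trans
    (UnitCocycle.toCartierDivisor_mul_sameDivisor _ _).linEquiv.symm
  exact LinEquiv.add D.toCartierDivisor_toUnitCocycle_linEquiv.symm
    E.toCartierDivisor_toUnitCocycle_linEquiv.symm

end CartierDivisor

end Literature.AlgebraicGeometry.Motives

/-! ### §2 Surjectivity: every class in `Ȟ¹(Y, 𝒪_Y^×)` is the class of a Cartier divisor -/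

namespace Literature.AlgebraicGeometry.Modules

open Literature.AlgebraicGeometry.Motives Literature.AlgebraicGeometry.Motives.RatFn

variable {Y : Scheme.{u}} [IsIntegral Y]

/-- **`[𝒪_Y(D_c)] = [c]`**: the class of the divisor `(U_x, g_{xξ})` of a unit cocycle is the class
of the cocycle — surjectivity of `DivCl(Y) → Pic(Y)` for `Y` integral (Görtz–Wedhorn I, Prop. 11.21;
Hartshorne II Prop. 6.15: "every invertible sheaf is `≅ 𝓛(D)`"). [cite: GortzWedhorn2020, Prop. 11.21 (p. 374)]
[cite: Hartshorne1977, II Prop. 6.15] -/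
theorem UnitCocycle.cechClass_toCartierDivisor (c : UnitCocycle Y) :
    c.toCartierDivisor.cechClass = CechPic.mk c := by
  rw [CartierDivisor.cechClass_eq_mk]
  exact CechPic.sound ((UnitCocycle.equiv_iff_toCartierDivisor_linEquiv _ _).2
    c.toCartierDivisor.toCartierDivisor_toUnitCocycle_linEquiv)

/-- Every class in `Ȟ¹(Y, 𝒪_Y^×)` is `[𝒪_Y(D)]` for some Cartier divisor `D`.
[cite: Hartshorne1977, II Prop. 6.15] -/
theorem CechPic.exists_cechClass_eq (γ : CechPic Y) : ∃ D : CartierDivisor Y, D.cechClass = γ := by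
  obtain ⟨c, rfl⟩ := CechPic.mk_surjective γ
  exact ⟨c.toCartierDivisor, c.cechClass_toCartierDivisor⟩

end Literature.AlgebraicGeometry.Modules

/-! ### §3 Compatibility with pull-back along a dominant morphism -/

namespace Literature.AlgebraicGeometry.Motives

namespace CartierDivisor

open RatFn Literature.AlgebraicGeometry.Modules

variable {Y Y' : Scheme.{u}} [IsIntegral Y] [IsIntegral Y'] (D : CartierDivisor Y) (g : Y' ⟶ Y)
  [IsDominant g]

/-- **`[𝒪_{Y'}(g^*D)] = g^*[𝒪_Y(D)]`** for a dominant morphism `g : Y' → Y` of integral schemes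
(Görtz–Wedhorn I, (11.16), p. 392: `g^*𝒪(D) ≅ 𝒪(g^*D)`): both cocycles live on the charts
`g⁻¹U_{i(g x')}` and have the rational function `g^♯(f_i / f_j)`. [cite: GortzWedhorn2020, Def. 11.49 (p. 392)] -/
theorem cechClass_pullback : (D.pullback g).cechClass = CechPic.pullback g D.cechClass := by
  rw [cechClass_eq_mk, cechClass_eq_mk, CechPic.pullback_mk]
  refine CechPic.sound (UnitCocycle.equiv_of_eq _ _ (fun x' => g ⁻¹ᵁ D.U (D.chartIdx (g.base x')))
    (fun x' => D.mem_U_chartIdx (g.base x')) (fun _ => le_rfl) (fun _ => le_rfl)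
    fun x' y' V hx hy => ?_)
  refine section_ext fun hV => ?_
  -- both sides have the rational function `g^♯(f_i / f_j)`, `i = i(g x')`, `j = i(g y')`
  have hU : genericPoint Y ∈ D.U (D.chartIdx (g.base x')) ⊓ D.U (D.chartIdx (g.base y')) :=
    ⟨genericPoint_mem_of_mem (D.mem_U_chartIdx (g.base x')),
      genericPoint_mem_of_mem (D.mem_U_chartIdx (g.base y'))⟩
  have lhs : ofSection hV ((UnitCocycle.pullback g D.toUnitCocycle).g x' y' V hx hy) =
      functionFieldMap g (D.f (D.chartIdx (g.base x')) / D.f (D.chartIdx (g.base y'))) := by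
    change ofSection hV (g.appLE _ V _ (Y.presheaf.map (homOfLE _).op (D.transFun _ _))) = _
    rw [Scheme.Hom.appLE, CommRingCat.comp_apply, ofSection_map, ← functionFieldMap_ofSection,
      ofSection_map, ofSection_transFun]
    exact hU
  have rhs : ofSection hV ((D.pullback g).toUnitCocycle.g x' y' V hx hy) =
      functionFieldMap g (D.f (D.chartIdx (g.base x')) / D.f (D.chartIdx (g.base y'))) := by
    change ofSection hV (Y'.presheaf.map (homOfLE _).op ((D.pullback g).transFun _ _)) = _
    rw [ofSection_map, ofSection_transFun, map_div₀]
    rfl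
  rw [lhs, rhs]

/-- The same for the class pull-back `CartierDivisor.classPullback` (which agrees with `pullback`
up to linear equivalence for dominant `g`, `classPullback_linEquiv_pullback`). [cite: GortzWedhorn2020, Prop. 11.21 (p. 374) and Def. 11.49 (p. 392)] -/
theorem cechClass_classPullback : (D.classPullback g).cechClass = CechPic.pullback g D.cechClass := by
  rw [(D.classPullback_linEquiv_pullback g).cechClass_eq, cechClass_pullback]

end CartierDivisor

end Literature.AlgebraicGeometry.Motives

end
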